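import Summits.CriticalPhenomena.CardyFormulaZ2.Theorems.CardyBoundaryCoulombGasHalfPlaneMarkDensityLawTwoArmPoint
import Summits.CriticalPhenomena.CardyFormulaZ2.Theorems.CardyBoundaryCoulombGasHalfPlaneMarkDensityLawSymmDiffInclusion
import Summits.CriticalPhenomena.CardyFormulaZ2.Theorems.CardyBoundaryCoulombGasHalfPlaneMarkDensityLawIsolationIndep
import Literature.Probability.Percolation.RSWProofs

/-!
# Lead's skeleton (c12-0) for the supports programme "β₂⁺ = 1 on bond-ℤ², lower half" of the crux
# `HalfPlaneMarkDensityLaw` (stmt-CriticalPhenomena-5661), line `Sketch`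

Stubs (registered on the item; each lands in its own Theorems file `--supports stmt-CriticalPhenomena-5661`):
* `stub_lisoAnti`      — the isolated-arm events `liso k R`, `riso k R` are antitone in `R` on lattice configurations;
* `stub_lisoOfGlobal`  — Werner's counting, deterministic half (mirrored, primal form): no LR crossing of the
  shield box `[0,q]×[0,4q]`, a TB crossing of `[2q,4q]×[0,4q]` and an LR crossing of `[2q,8q+1]×[0,4q]` force
  `liso u (4q)` at the leftmost point `u ∈ [0,4q]` of the bottom row joined in the strip to the column `8q+1`;
* `stub_globalEventProb` — that global event has probability `≥ c₀ > 0` for all `q ≥ 2` (RSW + duality +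
  Harris–FKG + independence of disjoint boxes);
* `stub_firstHitSuccLe` — unit-scale one-sided ratio bound for the crux's first-hit events:
  `P[E(k+1)] ≤ 4·P[E(k)]` (three-edge surgery, flip invariance of `P_{1/2}`);
* `stub_interleave`    — planarity: two lattice paths of `ℤ×ℕ` with interleaved feet `a < j < k < t` meet.
Assembly (this file, lead): `c/R ≤ P(liso k R)`, `c/R ≤ P(riso k R)` for `R ≥ R₀`; window form; the exponent
`log P(liso 0 n)/log n → −1`.
-/

noncomputable section

namespace Summit.CriticalPhenomena.CardyFormulaZ2.Cruxes.HalfPlaneMarkDensityLaw.SketchLine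

open Literature.Probability.Percolation Literature.Probability.LatticeModels
open MeasureTheory Filter Set SimpleGraph
open scoped Topology
open Summit.CriticalPhenomena.CardyFormulaZ2.Theorems.HalfPlaneMarkDensityLaw.Negative

namespace TwoArmLower

/-! ### The five stubs (statements in tree vocabulary only) -/

/-- STUB 1: antitonicity of the isolated-arm events in the radius, on lattice configurations. [folklore] -/
theorem stub_lisoAnti :
    ∀ (k : ℤ) (R R' : ℕ), R ≤ R' → ∀ ω : BondConfig (Site 2), ω ⊆ (zdGraph 2).edgeSet →
      (ω ∈ openCrossing {v : Site 2 | 0 ≤ v 1 ∧ v 1 ≤ (R' : ℤ) ∧ k - R' ≤ v 0 ∧ v 0 ≤ k + R'} {bpt k}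
              {v : Site 2 | v 0 = k - R' ∨ v 0 = k + R' ∨ v 1 = (R' : ℤ)} \
            openCrossing {v : Site 2 | 0 ≤ v 1 ∧ v 1 ≤ (R' : ℤ) ∧ k - R' ≤ v 0 ∧ v 0 ≤ k + R'}
              (rowIcc (k - R') (k - 1)) {bpt k} →
        ω ∈ openCrossing {v : Site 2 | 0 ≤ v 1 ∧ v 1 ≤ (R : ℤ) ∧ k - R ≤ v 0 ∧ v 0 ≤ k + R} {bpt k}
              {v : Site 2 | v 0 = k - R ∨ v 0 = k + R ∨ v 1 = (R : ℤ)} \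
            openCrossing {v : Site 2 | 0 ≤ v 1 ∧ v 1 ≤ (R : ℤ) ∧ k - R ≤ v 0 ∧ v 0 ≤ k + R}
              (rowIcc (k - R) (k - 1)) {bpt k}) ∧
      (ω ∈ openCrossing {v : Site 2 | 0 ≤ v 1 ∧ v 1 ≤ (R' : ℤ) ∧ k - R' ≤ v 0 ∧ v 0 ≤ k + R'} {bpt k}
              {v : Site 2 | v 0 = k - R' ∨ v 0 = k + R' ∨ v 1 = (R' : ℤ)} \
            openCrossing {v : Site 2 | 0 ≤ v 1 ∧ v 1 ≤ (R' : ℤ) ∧ k - R' ≤ v 0 ∧ v 0 ≤ k + R'}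
              (rowIcc (k + 1) (k + R')) {bpt k} →
        ω ∈ openCrossing {v : Site 2 | 0 ≤ v 1 ∧ v 1 ≤ (R : ℤ) ∧ k - R ≤ v 0 ∧ v 0 ≤ k + R} {bpt k}
              {v : Site 2 | v 0 = k - R ∨ v 0 = k + R ∨ v 1 = (R : ℤ)} \
            openCrossing {v : Site 2 | 0 ≤ v 1 ∧ v 1 ≤ (R : ℤ) ∧ k - R ≤ v 0 ∧ v 0 ≤ k + R}
              (rowIcc (k + 1) (k + R)) {bpt k}) := by
  sorry

/-- STUB 2: the deterministic half of Werner's counting argument (mirrored, primal form). [folklore] -/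
theorem stub_lisoOfGlobal :
    ∀ q : ℕ, 1 ≤ q → ∀ ω : BondConfig (Site 2), ω ⊆ (zdGraph 2).edgeSet →
      ω ∉ lrCrossing q (4 * q) →
      ω ∈ openCrossing ((· + (![2 * (q : ℤ), 0] : Site 2)) '' (↑(rectangle (2 * q) (4 * q)) : Set (Site 2)))
            ((· + (![2 * (q : ℤ), 0] : Site 2)) '' (↑(bottomSide (2 * q) (4 * q)) : Set (Site 2)))
            ((· + (![2 * (q : ℤ), 0] : Site 2)) '' (↑(topSide (2 * q) (4 * q)) : Set (Site 2))) →
      ω ∈ openCrossing ((· + (![2 * (q : ℤ), 0] : Site 2)) '' (↑(rectangle (6 * q + 1) (4 * q)) : Set (Site 2)))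
            ((· + (![2 * (q : ℤ), 0] : Site 2)) '' (↑(leftSide (6 * q + 1) (4 * q)) : Set (Site 2)))
            ((· + (![2 * (q : ℤ), 0] : Site 2)) '' (↑(rightSide (6 * q + 1) (4 * q)) : Set (Site 2))) →
      ∃ u : ℤ, 0 ≤ u ∧ u ≤ 4 * q ∧
        ω ∈ openCrossing {v : Site 2 | 0 ≤ v 1 ∧ v 1 ≤ ((4 * q : ℕ) : ℤ) ∧ u - (4 * q : ℕ) ≤ v 0 ∧ v 0 ≤ u + (4 * q : ℕ)}
                {bpt u} {v : Site 2 | v 0 = u - (4 * q : ℕ) ∨ v 0 = u + (4 * q : ℕ) ∨ v 1 = ((4 * q : ℕ) : ℤ)} \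
              openCrossing {v : Site 2 | 0 ≤ v 1 ∧ v 1 ≤ ((4 * q : ℕ) : ℤ) ∧ u - (4 * q : ℕ) ≤ v 0 ∧ v 0 ≤ u + (4 * q : ℕ)}
                (rowIcc (u - (4 * q : ℕ)) (u - 1)) {bpt u} := by
  sorry

/-- STUB 3: the probabilistic half — the global event has probability bounded below. [folklore] -/
theorem stub_globalEventProb :
    ∃ c₀ : ℝ, 0 < c₀ ∧ ∀ q : ℕ, 2 ≤ q →
      c₀ ≤ μ.real ((lrCrossing q (4 * q))ᶜ ∩
        (openCrossing ((· + (![2 * (q : ℤ), 0] : Site 2)) '' (↑(rectangle (2 * q) (4 * q)) : Set (Site 2)))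
            ((· + (![2 * (q : ℤ), 0] : Site 2)) '' (↑(bottomSide (2 * q) (4 * q)) : Set (Site 2)))
            ((· + (![2 * (q : ℤ), 0] : Site 2)) '' (↑(topSide (2 * q) (4 * q)) : Set (Site 2))) ∩
         openCrossing ((· + (![2 * (q : ℤ), 0] : Site 2)) '' (↑(rectangle (6 * q + 1) (4 * q)) : Set (Site 2)))
            ((· + (![2 * (q : ℤ), 0] : Site 2)) '' (↑(leftSide (6 * q + 1) (4 * q)) : Set (Site 2)))
            ((· + (![2 * (q : ℤ), 0] : Site 2)) '' (↑(rightSide (6 * q + 1) (4 * q)) : Set (Site 2))))) := by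
  sorry

/-- STUB 4: unit-scale one-sided ratio bound for first-hit events of a boundary arc left of the window:
`P[E(k+1)] ≤ 4 · P[E(k)]`. [folklore] -/
theorem stub_firstHitSuccLe :
    ∀ (α β k₀ k : ℤ), β < k₀ → k₀ ≤ k →
      μ.real (firstHit halfPlane (rowIcc α β) k₀ (k + 1)) ≤ 4 * μ.real (firstHit halfPlane (rowIcc α β) k₀ k) := by
  sorry

/-- STUB 5: interleaved feet force an intersection (planarity of `ℤ × ℕ`). [folklore] -/
theorem stub_interleave :
    ∀ (a j k t : ℤ), a < j → j < k → k < t →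
      ∀ (P : (zdGraph 2).Walk (bpt a) (bpt k)) (Q : (zdGraph 2).Walk (bpt j) (bpt t)),
        (∀ z ∈ P.support, 0 ≤ z 1) → (∀ z ∈ Q.support, 0 ≤ z 1) → ∃ z ∈ P.support, z ∈ Q.support := by
  sorry

/-! ### Sanity: the stubs speak about the tree's `liso` / `riso` -/

open TwoArm in
/-- The explicit events of the stubs are `TwoArm.liso` / `TwoArm.riso`. [folklore] -/
theorem stub_lisoAnti_iff :
    (∀ (k : ℤ) (R R' : ℕ), R ≤ R' → ∀ ω : BondConfig (Site 2), ω ⊆ (zdGraph 2).edgeSet →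
      (ω ∈ liso k R' → ω ∈ liso k R) ∧ (ω ∈ riso k R' → ω ∈ riso k R)) := by
  intro k R R' h ω hω
  exact stub_lisoAnti k R R' h ω hω

end TwoArmLower

end Summit.CriticalPhenomena.CardyFormulaZ2.Cruxes.HalfPlaneMarkDensityLaw.SketchLine
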